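import Literature.Geometry.DiscreteGeometry.DelsarteLinearProgrammingBound
import Literature.Analysis.SpecialFunctions.GegenbauerOrthogonality

/-!
# Weighted complementary slackness: zero Gegenbauer moments hold point by point

Framing: lottery ticket; floor = certified bounds/negative ranges. Venture `PackingBounds` (cell
`pub-packcert`, seat `pub-packcert-energy`).

For unit vectors `x_1, …, x_N ∈ ℝⁿ` (`n = 2μ + 2 ≥ 3`) the Gegenbauer matrix `[C_k^{(μ)}(⟨x_a, x_b⟩)]_{a,b}`
is positive semidefinite (addition theorem; tree: `Literature…sum_mul_gegenbauerHom_nonneg`). A positive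
semidefinite symmetric real matrix whose total sum `1ᵀ M 1` vanishes has `M 1 = 0`, i.e. all row sums vanish
(`rowSum_eq_zero_of_psd`, from the nonnegativity of `t ↦ (1 + t e_a)ᵀ M (1 + t e_a)`). Hence whenever the
TOTAL moment `Σ_{x,y ∈ C} C_k(⟨x,y⟩)` of a configuration vanishes (as complementary slackness gives for
LP-sharp codes, e.g. `Kissing.kissing_dim24_moments_of_card_eq_196560`), the moment vanishes around every
point: `Σ_{y ∈ C} C_k(⟨x,y⟩) = 0` for each `x ∈ C` (`pointMoment_eq_zero_of_total`) — the per-point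
(design / distance-regularity) form used in `Configurations/LeechDesign.lean` and `E8Design.lean`.

## References
* P. Delsarte, J.-M. Goethals, J. J. Seidel, *Spherical codes and designs*, Geom. Dedicata 6 (1977) 363–388, §4.
* E. Bannai, N. J. A. Sloane, Canad. J. Math. 33 (1981) 437–449 (= Conway–Sloane, *SPLAG*, Ch. 14). [`ConwaySloane1999`]
-/

namespace Summit.Ventures.PackingBounds.Config.DesignSlackness

open Finset Literature.Analysis.SpecialFunctions Literature.Geometry.DiscreteGeometry

/-- If `t ↦ 2 R t + G t²` is nonnegative for every real `t`, then `R = 0`. -/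
theorem eq_zero_of_quadratic_nonneg {R G : ℝ} (h : ∀ t : ℝ, 0 ≤ 2 * R * t + G * t ^ 2) : R = 0 := by
  by_contra hR
  have hpos : 0 < R ^ 2 := by positivity
  have key := h (-R / (|G| + 1))
  have : 2 * R * (-R / (|G| + 1)) + G * (-R / (|G| + 1)) ^ 2 = R ^ 2 * (G - 2 * (|G| + 1)) / (|G| + 1) ^ 2 := by
    field_simp
    ring
  rw [this] at key
  have hneg : G - 2 * (|G| + 1) < 0 := by linarith [le_abs_self G, abs_nonneg G]
  have : R ^ 2 * (G - 2 * (|G| + 1)) / (|G| + 1) ^ 2 < 0 :=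
    div_neg_of_neg_of_pos (mul_neg_of_pos_of_neg hpos hneg) (by positivity)
  linarith

/-- **Row sums of a positive semidefinite symmetric matrix with zero total sum vanish** (`1ᵀM1 = 0 ⇒ M1 = 0`). -/
theorem rowSum_eq_zero_of_psd {ι : Type*} [Fintype ι] [DecidableEq ι] (M : ι → ι → ℝ)
    (hsym : ∀ a b, M a b = M b a) (hpsd : ∀ c : ι → ℝ, 0 ≤ ∑ a, ∑ b, c a * c b * M a b)
    (h0 : ∑ a, ∑ b, M a b = 0) (a₀ : ι) : ∑ b, M a₀ b = 0 := by
  apply eq_zero_of_quadratic_nonneg (G := M a₀ a₀)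
  intro t
  have hq := hpsd fun a => 1 + if a = a₀ then t else 0
  have hexp : ∑ a, ∑ b, (1 + if a = a₀ then t else 0) * (1 + if b = a₀ then t else 0) * M a b =
      (∑ a, ∑ b, M a b) + t * (∑ b, M a₀ b) + t * (∑ a, M a a₀) + t ^ 2 * M a₀ a₀ := by
    have hterm : ∀ a b, (1 + if a = a₀ then t else 0) * (1 + if b = a₀ then t else 0) * M a b =
        M a b + (if a = a₀ then t * M a b else 0) + (if b = a₀ then t * M a b else 0) +
          (if a = a₀ then (if b = a₀ then t ^ 2 * M a b else 0) else 0) := by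
      intro a b; split_ifs <;> ring
    simp only [hterm, Finset.sum_add_distrib, Finset.sum_ite_eq', Finset.mem_univ, if_true, Finset.sum_ite_irrel,
      Finset.sum_const_zero, ← Finset.mul_sum]
  have hcol : ∑ a, M a a₀ = ∑ b, M a₀ b := Finset.sum_congr rfl fun a _ => hsym a a₀
  rw [hexp, h0, hcol] at hq
  linarith

/-- **Per-point moments from the total moment.** For unit vectors `C ⊂ ℝⁿ` (`n = 2μ + 2`, `μ > 0`): if the
total Gegenbauer moment `Σ_{x,y ∈ C} C_k^{(μ)}(⟨x,y⟩)` vanishes, then `Σ_{y ∈ C} C_k^{(μ)}(⟨x,y⟩) = 0` for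
every `x ∈ C` (positive semidefiniteness of the Gegenbauer matrix). [cite: ConwaySloane1999, Ch. 14 §3] -/
theorem pointMoment_eq_zero_of_total {n : ℕ} {μ : ℝ} (hn : (n : ℝ) = 2 * μ + 2) (hμ : 0 < μ)
    (C : Finset (EuclideanSpace ℝ (Fin n))) (h1 : ∀ x ∈ C, ‖x‖ = 1) (k : ℕ)
    (htot : ∑ x ∈ C, ∑ y ∈ C, gegenbauerSum μ k (inner ℝ x y) = 0) {x : EuclideanSpace ℝ (Fin n)}
    (hx : x ∈ C) : ∑ y ∈ C, gegenbauerSum μ k (inner ℝ x y) = 0 := by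
  classical
  have hM := rowSum_eq_zero_of_psd (ι := C)
    (fun a b => gegenbauerSum μ k (inner ℝ (a : EuclideanSpace ℝ (Fin n)) b))
    (fun a b => by simp only [real_inner_comm]) ?_ ?_ ⟨x, hx⟩
  · rw [← Finset.sum_coe_sort C]
    exact hM
  · intro c
    have hpos := sum_mul_gegenbauerHom_nonneg (n := n) (μ := μ) hn hμ k
      (fun a : C => fun j => (a : EuclideanSpace ℝ (Fin n)) j) c
    have hunit : ∀ a : C, ∑ j, (a : EuclideanSpace ℝ (Fin n)) j ^ 2 = 1 := fun a => by
      rw [← EuclideanSpace.real_norm_sq_eq, h1 a a.2, one_pow]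
    have hinner : ∀ a b : C, inner ℝ (a : EuclideanSpace ℝ (Fin n)) b =
        ∑ j, (a : EuclideanSpace ℝ (Fin n)) j * (b : EuclideanSpace ℝ (Fin n)) j := fun a b => by
      simp [PiLp.inner_apply, mul_comm]
    simp only [hunit, mul_one] at hpos
    simpa only [hinner, gegenbauerSum_eq_gegenbauerHom] using hpos
  · rw [← Finset.sum_coe_sort C] at htot
    simp_rw [← Finset.sum_coe_sort C] at htot
    exact htot

end Summit.Ventures.PackingBounds.Config.DesignSlackness
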